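import Literature.Topology.FourManifolds.FishtailLambda
import HarnessLib

/-!
# The smooth lift of the clutching map at the hole (Cartesian geometry)

Model side of Gompf's handle chart for R. Gompf, *More Cappell–Shaneson spheres are standard*,
Algebr. Geom. Topol. 10 (2010), Lemma 2.2 (`Φ = N ∪_γ 2-handle` with framing `∓1`), in the layout
where the hole of the box sits on the flat far face (`FishtailFace.lean`). In the offset
coordinate `v ∈ ℂ` of the base about the hole (`v₁ = n - n_j` along Gompf's base circle,
`v₂` increasing with the model base `s` across the seam), the trivialising correction of the
model `𝕊¹`-bundle is `T = 2π g_L τ̂`, `g_L = [v₁ < 0]` (the real lift of the clutching function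
cut at `n_j`) and `τ̂` a step across `v₂ ∈ [-w, w]` (the seam plateau). The circle map
`v ↦ (v/|v|) e^{iT}` has degree zero on every annulus about the slit `{v₁ = 0, |v₂| ≤ w}`, and

* `Literature.Topology.FourManifolds.holeLift w v = arg v + 2π g_L (τ̂(v₂) - [0 ≤ v₂])` is a
  **smooth real lift of it off the slit** (`contDiffAt_holeLift`, `exp_holeLift_mul_I`) — the
  Cartesian analogue of `modelLift` / `seamCorrG` (`FishtailLambda.lean`, `FishtailSection.lean`);
* `Literature.Topology.FourManifolds.holeS r₁ r₂ w = capBlend r₁ r₂ |v| · holeLift w` is its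
  cut-off, **smooth on the whole plane** when `w < r₁` (`contDiffAt_holeS`), equal to the lift for
  `|v| ≥ r₂` and to `0` for `|v| ≤ r₁`;

so that `fishLambda c (holeS r₁ r₂ w)` (`FishtailLambda.lean`, generic in the lift) is the handle
identification `Λ(v, ℓ₂) = (c v e^{-i(S̃ - ℓ₂)}, S̃ - ℓ₂)` of the hole region with `D × 𝕊¹`.

Everything is proved; no named facts.

## References

* R. E. Gompf, *More Cappell–Shaneson spheres are standard*, Algebr. Geom. Topol. 10 (2010)
  1665–1681, Lemma 2.2 and its proof. [GompfAGT2010]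
-/

noncomputable section

open scoped Real ContDiff Topology
open Set Function Complex Filter

namespace Literature.Topology.FourManifolds

/-! ### The step across the seam window and the two indicators -/

section Step

/-- **The step across `[-w, w]`**: `τ̂(x) = λ((x + w)/(2w))`, `0` for `x ≤ -w`, `1` for `x ≥ w`. [folklore] -/
def stepW (w x : ℝ) : ℝ := Real.smoothTransition ((x + w) / (2 * w))

variable {w : ℝ}

/-- Below `-w` the step is `0`. [folklore] -/
theorem stepW_of_le (hw : 0 < w) {x : ℝ} (hx : x ≤ -w) : stepW w x = 0 :=
  Real.smoothTransition.zero_of_nonpos (div_nonpos_of_nonpos_of_nonneg (by linarith) (by linarith))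

/-- Above `w` the step is `1`. [folklore] -/
theorem stepW_of_ge (hw : 0 < w) {x : ℝ} (hx : w ≤ x) : stepW w x = 1 :=
  Real.smoothTransition.one_of_one_le (by rw [le_div_iff₀ (by linarith)]; linarith)

/-- The step is smooth. [folklore] -/
theorem contDiff_stepW (w : ℝ) : ContDiff ℝ ∞ (stepW w) :=
  Real.smoothTransition.contDiff.comp ((contDiff_id.add contDiff_const).div_const _)

/-- **The left indicator** `g_L(v) = [re v < 0]` (the real lift of the clutching function, divided
by `2π`, near the hole). [folklore] -/
def gLeft (v : ℂ) : ℝ := if v.re < 0 then 1 else 0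

/-- **The upper indicator** `[0 ≤ im v]`. [folklore] -/
def gUpper (v : ℂ) : ℝ := if 0 ≤ v.im then 1 else 0

end Step

/-! ### The lift -/

section Lift

variable (w : ℝ)

/-- **The smooth lift at the hole**: `L(v) = arg v + 2π g_L(v) (τ̂(im v) - [0 ≤ im v])`. [cite: GompfAGT2010, Lemma 2.2 (proof: ∂Φ is ∂N surgered along γ, the gluing map supported in a single fibre)] -/
def holeLift (v : ℂ) : ℝ := arg v + 2 * π * gLeft v * (stepW w v.im - gUpper v)

variable {w}

/-- **`e^{iL} = (v/|v|) e^{2πi g_L τ̂}`** (`v ≠ 0`): the lift exponentiates to the clutching-corrected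
direction. [folklore] -/
theorem exp_holeLift_mul_I {v : ℂ} (hv : v ≠ 0) :
    exp (holeLift w v * I) = v / ‖v‖ * exp ((2 * π * gLeft v * stepW w v.im : ℝ) * I) := by
  have hdir : exp (arg v * I) = v / ‖v‖ := by
    have h := Complex.norm_mul_exp_arg_mul_I v
    have hn : (‖v‖ : ℂ) ≠ 0 := by exact_mod_cast norm_ne_zero_iff.2 hv
    field_simp
    rw [mul_comm]; exact h
  have hU : exp (-(2 * π * gLeft v * gUpper v : ℝ) * I) = 1 := by
    unfold gLeft gUpper
    split_ifs <;> norm_num [Complex.exp_neg, ← Complex.exp_int_mul_two_pi_mul_I 1]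
  rw [holeLift, show ((arg v + 2 * π * gLeft v * (stepW w v.im - gUpper v) : ℝ) : ℂ) * I =
      arg v * I + (2 * π * gLeft v * stepW w v.im : ℝ) * I + -(2 * π * gLeft v * gUpper v : ℝ) * I by
      push_cast; ring, Complex.exp_add, Complex.exp_add, hdir, hU, mul_one]

/-- **Smoothness of the lift off the slit**: at every `v` with `re v ≠ 0` or `|im v| > w` (such `v` are nonzero). [folklore] -/
theorem contDiffAt_holeLift (hw : 0 < w) {v : ℂ} (hs : v.re ≠ 0 ∨ w < |v.im|) :
    ContDiffAt ℝ ∞ (holeLift w) v := by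
  have hstep : ContDiffAt ℝ ∞ (fun u : ℂ ↦ stepW w u.im) v :=
    (contDiff_stepW w).contDiffAt.comp v Complex.imCLM.contDiff.contDiffAt
  rcases lt_trichotomy v.re 0 with hre | hre | hre
  · -- left half-plane: `g_L = 1` near `v`
    have hL : ∀ᶠ u in 𝓝 v, gLeft u = 1 := by
      filter_upwards [(isOpen_lt Complex.continuous_re continuous_const).mem_nhds hre] with u hu
      exact if_pos hu
    rcases lt_trichotomy v.im 0 with him | him | him
    · -- lower-left: `L = arg + 2π τ̂`
      have hev : holeLift w =ᶠ[𝓝 v] fun u ↦ arg u + 2 * π * stepW w u.im := by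
        filter_upwards [hL, (isOpen_lt Complex.continuous_im continuous_const).mem_nhds him] with u hu hui
        rw [holeLift, hu, gUpper, if_neg (not_le.2 hui)]; ring
      exact ((contDiffAt_arg (Or.inr him.ne)).add (contDiffAt_const.mul hstep)).congr_of_eventuallyEq hev
    · -- negative real axis: `L = arg(-u) - π + 2π τ̂`
      have hev : holeLift w =ᶠ[𝓝 v] fun u ↦ arg (-u) - π + 2 * π * stepW w u.im := by
        filter_upwards [hL] with u hu
        rw [holeLift, hu, gUpper]
        rcases lt_trichotomy u.im 0 with hui | hui | hui
        · rw [if_neg (not_le.2 hui), arg_neg_eq_arg_add_pi_of_im_neg hui]; ring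
        · have hur : u.re < 0 := by have := hu; unfold gLeft at this; split_ifs at this with h; exact h; norm_num at this
          have hu0 : u = (u.re : ℂ) := Complex.ext rfl (by simp [hui])
          rw [if_pos hui.symm.le, hu0, Complex.arg_ofReal_of_neg hur, ← Complex.ofReal_neg,
            Complex.arg_ofReal_of_nonneg (by linarith)]
          ring
        · rw [if_pos hui.le, arg_neg_eq_arg_sub_pi_of_im_pos hui]; ring
      have hneg : -v ∈ slitPlane := Or.inl (by simp; linarith)
      exact ((((contDiffAt_arg hneg).comp v contDiff_neg.contDiffAt).sub contDiffAt_const).add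
        (contDiffAt_const.mul hstep)).congr_of_eventuallyEq hev
    · -- upper-left: `L = arg + 2π (τ̂ - 1)`
      have hev : holeLift w =ᶠ[𝓝 v] fun u ↦ arg u + 2 * π * (stepW w u.im - 1) := by
        filter_upwards [hL, (isOpen_lt continuous_const Complex.continuous_im).mem_nhds him] with u hu hui
        rw [holeLift, hu, gUpper, if_pos hui.le]; ring
      exact ((contDiffAt_arg (Or.inr him.ne')).add (contDiffAt_const.mul (hstep.sub contDiffAt_const))).congr_of_eventuallyEq hev
  · -- the imaginary axis off the slit: `|im v| > w`, locally `L = arg`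
    have hw' : w < |v.im| := hs.resolve_left (not_not.2 hre)
    rcases lt_or_gt_of_ne (show v.im ≠ 0 from fun h ↦ by rw [h, abs_zero] at hw'; linarith) with him | him
    · have hvw : v.im < -w := by rw [abs_of_neg him] at hw'; linarith
      have hev : holeLift w =ᶠ[𝓝 v] fun u ↦ arg u := by
        filter_upwards [(isOpen_lt Complex.continuous_im continuous_const).mem_nhds hvw] with u hu
        rw [holeLift, stepW_of_le hw hu.le, gUpper, if_neg (by linarith)]; ring
      exact (contDiffAt_arg (Or.inr him.ne)).congr_of_eventuallyEq hev
    · have hvw : w < v.im := by rw [abs_of_pos him] at hw'; exact hw'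
      have hev : holeLift w =ᶠ[𝓝 v] fun u ↦ arg u := by
        filter_upwards [(isOpen_lt continuous_const Complex.continuous_im).mem_nhds hvw] with u hu
        rw [holeLift, stepW_of_ge hw hu.le, gUpper, if_pos (by linarith)]; ring
      exact (contDiffAt_arg (Or.inr him.ne')).congr_of_eventuallyEq hev
  · -- right half-plane: `g_L = 0` near `v`, `L = arg`
    have hev : holeLift w =ᶠ[𝓝 v] fun u ↦ arg u := by
      filter_upwards [(isOpen_lt continuous_const Complex.continuous_re).mem_nhds hre] with u hu
      rw [holeLift, gLeft, if_neg (not_lt.2 hu.le)]; ring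
    exact (contDiffAt_arg (Or.inl hre)).congr_of_eventuallyEq hev

end Lift

/-! ### The cut-off lift, smooth on the whole plane -/

section CutOff

variable (r₁ r₂ w : ℝ)

/-- **The cut-off lift** `S̃(v) = β(|v|) L(v)` (`β = capBlend r₁ r₂`: `0` for `|v| ≤ r₁`, `1` for
`|v| ≥ r₂`). [folklore] -/
def holeS (v : ℂ) : ℝ := capBlend r₁ r₂ ‖v‖ * holeLift w v

variable {r₁ r₂ w}

/-- Beyond `r₂` the cut-off lift is the lift. [folklore] -/
theorem holeS_of_le_norm (h12 : r₁ < r₂) {v : ℂ} (hv : r₂ ≤ ‖v‖) : holeS r₁ r₂ w v = holeLift w v := by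
  rw [holeS, capBlend, Real.smoothTransition.one_of_one_le (by rw [le_div_iff₀ (sub_pos.2 h12)]; linarith), one_mul]

/-- Within `r₁` the cut-off lift vanishes. [folklore] -/
theorem holeS_of_norm_le (h12 : r₁ < r₂) {v : ℂ} (hv : ‖v‖ ≤ r₁) : holeS r₁ r₂ w v = 0 := by
  rw [holeS, capBlend, Real.smoothTransition.zero_of_nonpos
    (div_nonpos_of_nonpos_of_nonneg (by linarith) (sub_pos.2 h12).le), zero_mul]

/-- **The cut-off lift is smooth everywhere** when the slit half-width is below the inner radius
(`0 < w < r₁ < r₂`). [folklore] -/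
theorem contDiffAt_holeS (hw : 0 < w) (h1 : w < r₁) (h12 : r₁ < r₂) (v : ℂ) : ContDiffAt ℝ ∞ (holeS r₁ r₂ w) v := by
  rcases lt_or_ge ‖v‖ r₁ with hin | hout
  · have hev : holeS r₁ r₂ w =ᶠ[𝓝 v] fun _ ↦ 0 := by
      filter_upwards [(isOpen_lt continuous_norm continuous_const).mem_nhds hin] with u hu
      exact holeS_of_norm_le h12 hu.le
    exact contDiffAt_const.congr_of_eventuallyEq hev
  · have hv : v ≠ 0 := by
      intro h; rw [h, norm_zero] at hout; linarith
    have hs : v.re ≠ 0 ∨ w < |v.im| := by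
      by_cases hre : v.re = 0
      · right
        have : ‖v‖ = |v.im| := by
          rw [Complex.norm_eq_sqrt_sq_add_sq, hre]; simp [Real.sqrt_sq_eq_abs]
        rw [← this]; linarith
      · exact Or.inl hre
    have hβ : ContDiffAt ℝ ∞ (fun u : ℂ ↦ capBlend r₁ r₂ ‖u‖) v :=
      (Real.smoothTransition.contDiff.comp ((contDiff_id.sub contDiff_const).div_const _)).contDiffAt.comp v
        (contDiffAt_norm ℝ hv)
    exact hβ.mul (contDiffAt_holeLift hw hs)

/-- **The cut-off lift on the collar exponentiates to the clutching-corrected direction**: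
for `|v| ≥ r₂`, `e^{-iS̃} · (v/|v|) = e^{-2πi g_L τ̂}`. [folklore] -/
theorem exp_neg_holeS_mul_unit (h12 : r₁ < r₂) (hr : 0 < r₂) {v : ℂ} (hv : r₂ ≤ ‖v‖) :
    exp (-(holeS r₁ r₂ w v * I)) * (v / ‖v‖) = exp (-((2 * π * gLeft v * stepW w v.im : ℝ) * I)) := by
  have hv0 : v ≠ 0 := by intro h; rw [h, norm_zero] at hv; linarith
  have hn : (‖v‖ : ℂ) ≠ 0 := by exact_mod_cast norm_ne_zero_iff.2 hv0
  rw [holeS_of_le_norm h12 hv, Complex.exp_neg, Complex.exp_neg, exp_holeLift_mul_I hv0]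
  have he : exp ((2 * π * gLeft v * stepW w v.im : ℝ) * I) ≠ 0 := Complex.exp_ne_zero _
  field_simp

end CutOff

end Literature.Topology.FourManifolds
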